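import Literature.AnabelianGeometry.SemiGraphs.UniversalCoveringOverHomogeneous
import Literature.AnabelianGeometry.SemiGraphs.UniversalCoveringOverLift

/-!
# Descent of automorphisms along `𝒢_{∞,T} → 𝒢_{∞,S}` ([SemiAnbd] §3 p. 38)

[SemiAnbd] p. 38: "we may choose compatible maps `𝒢_{∞,j} → 𝒢_{∞,i}`, hence [maps]
`Gal(𝒢_{∞,j}/𝒢) → Gal(𝒢_{∞,i}/𝒢)`".  For a morphism `f : T ⟶ S` of coverings (with `S` point-transitive,
e.g. Galois) and the induced `π : 𝒢_{∞,T} → 𝒢_{∞,S}`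
(`univCoverOverMap`), every automorphism `φ` of `𝒢_{∞,T}` DESCENDS uniquely to an automorphism
`descend φ` of `𝒢_{∞,S}` with `φ ≫ π = π ≫ descend φ`: existence by the transitivity of
`Aut(𝒢_{∞,S})` on fibres (`exists_aut_apply_eq`), uniqueness and multiplicativity by rigidity
(`univCoverOver_hom_ext`).  Result: the group homomorphism `descendHom : Aut 𝒢_{∞,T} →* Aut 𝒢_{∞,S}`.
-/

namespace Literature.AnabelianGeometry.SemiGraphs

namespace ProfiniteSemiGraph

open CategoryTheory

universe u

variable {𝒢 : ProfiniteSemiGraph.{u}} {T S : CovObj 𝒢} (f : T ⟶ S) (W₀ : T.OVertex)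
  (h𝒢 : 𝒢.IsCountable)

/-- The base point `(W₀, x₀, 𝟙)` of `𝒢_{∞,T}` based at the vertex-orbit `W₀` (for a chosen
representative `x₀` of `W₀`). [cite: MochizukiSemiAnbd2006, Prop 3.6 p.38] -/
noncomputable def CovObj.basePt : T.FibV (Sum.inl W₀) (CovObj.OVertex.base T W₀) :=
  ⟨⟨W₀, rfl⟩, ⟨⟨(CovObj.OVertex.exists_rep T W₀).choose, (CovObj.OVertex.exists_rep T W₀).choose_spec⟩,
    𝟙 _⟩⟩

/-- The projection `π : 𝒢_{∞,T} → 𝒢_{∞,S}` induced by `f` (based at `W₀` and `f̄ W₀`).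
[cite: MochizukiSemiAnbd2006, Prop 3.6 p.38] -/
noncomputable abbrev CovObj.projOver :
    T.univCoverOver (Sum.inl W₀) h𝒢 ⟶ S.univCoverOver (Sum.inl (CovObj.OVertex.map f W₀)) h𝒢 :=
  CovObj.univCoverOverMap f (Sum.inl W₀) h𝒢

variable
  (htrans : ∀ (v : 𝒢.graph.Vertex) (x x' : (S.SV v).obj.V), ∃ σ : S ⟶ S, (σ.fV v).hom.hom x = x')

include htrans

variable {f W₀ h𝒢} in
/-- Existence of a descended automorphism. [cite: MochizukiSemiAnbd2006, Prop 3.6 p.38] -/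
theorem CovObj.exists_descend (φ : Aut (T.univCoverOver (Sum.inl W₀) h𝒢)) :
    ∃ η : Aut (S.univCoverOver (Sum.inl (CovObj.OVertex.map f W₀)) h𝒢),
      (η.hom.fV _).hom.hom (((CovObj.projOver f W₀ h𝒢).fV _).hom.hom (CovObj.basePt W₀)) =
        ((CovObj.projOver f W₀ h𝒢).fV _).hom.hom ((φ.hom.fV _).hom.hom (CovObj.basePt W₀)) :=
  S.exists_aut_apply_eq' h𝒢 (CovObj.OVertex.map f W₀) htrans _ _

/-- **The descent of an automorphism of `𝒢_{∞,T}` to `𝒢_{∞,S}`.**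
[cite: MochizukiSemiAnbd2006, Prop 3.6 p.38] -/
noncomputable def CovObj.descend (φ : Aut (T.univCoverOver (Sum.inl W₀) h𝒢)) :
    Aut (S.univCoverOver (Sum.inl (CovObj.OVertex.map f W₀)) h𝒢) :=
  (CovObj.exists_descend htrans φ).choose

/-- The defining equation `φ ≫ π = π ≫ descend φ`. [cite: MochizukiSemiAnbd2006, Prop 3.6 p.38] -/
theorem CovObj.hom_comp_projOver (φ : Aut (T.univCoverOver (Sum.inl W₀) h𝒢)) :
    φ.hom ≫ CovObj.projOver f W₀ h𝒢 =
      CovObj.projOver f W₀ h𝒢 ≫ (CovObj.descend f W₀ h𝒢 htrans φ).hom := by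
  refine T.univCoverOver_hom_ext _ h𝒢 _ _ (CovObj.basePt W₀) ?_
  exact ((CovObj.exists_descend htrans φ).choose_spec).symm

/-- Uniqueness of the descent. [cite: MochizukiSemiAnbd2006, Prop 3.6 p.38] -/
theorem CovObj.descend_unique (φ : Aut (T.univCoverOver (Sum.inl W₀) h𝒢))
    (η : Aut (S.univCoverOver (Sum.inl (CovObj.OVertex.map f W₀)) h𝒢))
    (hη : φ.hom ≫ CovObj.projOver f W₀ h𝒢 = CovObj.projOver f W₀ h𝒢 ≫ η.hom) :
    η = CovObj.descend f W₀ h𝒢 htrans φ := by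
  apply Iso.ext
  refine S.univCoverOver_hom_ext _ h𝒢 _ _
    (((CovObj.projOver f W₀ h𝒢).fV _).hom.hom (CovObj.basePt W₀)) ?_
  have h1 := congrArg (fun ξ => (ξ.fV (CovObj.OVertex.base T W₀)).hom.hom (CovObj.basePt W₀)) hη
  have h2 := congrArg (fun ξ => (ξ.fV (CovObj.OVertex.base T W₀)).hom.hom (CovObj.basePt W₀))
    (CovObj.hom_comp_projOver f W₀ h𝒢 htrans φ)
  exact h1.symm.trans h2

/-- `descend 1 = 1`. [cite: MochizukiSemiAnbd2006, Prop 3.6 p.38] -/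
theorem CovObj.descend_one : CovObj.descend f W₀ h𝒢 htrans 1 = 1 := by
  symm
  apply CovObj.descend_unique
  rfl

/-- `descend (φ * ψ) = descend φ * descend ψ`. [cite: MochizukiSemiAnbd2006, Prop 3.6 p.38] -/
theorem CovObj.descend_mul (φ ψ : Aut (T.univCoverOver (Sum.inl W₀) h𝒢)) :
    CovObj.descend f W₀ h𝒢 htrans (φ * ψ) =
      CovObj.descend f W₀ h𝒢 htrans φ * CovObj.descend f W₀ h𝒢 htrans ψ := by
  symm
  apply CovObj.descend_unique
  change (ψ.hom ≫ φ.hom) ≫ _ = _ ≫ ((CovObj.descend f W₀ h𝒢 htrans ψ).hom ≫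
    (CovObj.descend f W₀ h𝒢 htrans φ).hom)
  rw [Category.assoc, CovObj.hom_comp_projOver f W₀ h𝒢 htrans φ, ← Category.assoc,
    CovObj.hom_comp_projOver f W₀ h𝒢 htrans ψ, Category.assoc]

/-- **The descent homomorphism `Aut(𝒢_{∞,T}) →* Aut(𝒢_{∞,S})`** ("`Gal(𝒢_{∞,j}/𝒢) → Gal(𝒢_{∞,i}/𝒢)`",
[SemiAnbd] p. 38). [cite: MochizukiSemiAnbd2006, Prop 3.6 p.38] -/
noncomputable def CovObj.descendHom :
    Aut (T.univCoverOver (Sum.inl W₀) h𝒢) →* Aut (S.univCoverOver (Sum.inl (CovObj.OVertex.map f W₀)) h𝒢) where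
  toFun := CovObj.descend f W₀ h𝒢 htrans
  map_one' := CovObj.descend_one f W₀ h𝒢 htrans
  map_mul' := CovObj.descend_mul f W₀ h𝒢 htrans

/-- The kernel of descent: `φ` descends to the identity iff `φ ≫ π = π`.
[cite: MochizukiSemiAnbd2006, Prop 3.6 p.38] -/
theorem CovObj.descend_eq_one_iff (φ : Aut (T.univCoverOver (Sum.inl W₀) h𝒢)) :
    CovObj.descend f W₀ h𝒢 htrans φ = 1 ↔ φ.hom ≫ CovObj.projOver f W₀ h𝒢 = CovObj.projOver f W₀ h𝒢 := by
  constructor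
  · intro h
    have := CovObj.hom_comp_projOver f W₀ h𝒢 htrans φ
    rw [h] at this
    exact this.trans (Category.comp_id _)
  · intro h
    symm
    apply CovObj.descend_unique
    exact h.trans (Category.comp_id _).symm

/-- **Descent is surjective**: every automorphism of `𝒢_{∞,S}` lifts to `𝒢_{∞,T}` (when `T` too is
connected with point-transitive endomorphisms), by fibre-surjectivity of `π` and transitivity of
`Aut(𝒢_{∞,T})`. [cite: MochizukiSemiAnbd2006, Prop 3.6 p.38] -/
theorem CovObj.descend_surjective
    (htransT : ∀ (v : 𝒢.graph.Vertex) (x x' : (T.SV v).obj.V), ∃ σ : T ⟶ T, (σ.fV v).hom.hom x = x') :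
    Function.Surjective (CovObj.descend f W₀ h𝒢 htrans) := by
  intro ψ
  obtain ⟨t₁, ht₁⟩ := CovObj.univCoverOverMap_fV_surjective f W₀ h𝒢 _
    ((ψ.hom.fV _).hom.hom (((CovObj.projOver f W₀ h𝒢).fV _).hom.hom (CovObj.basePt W₀)))
  obtain ⟨φ, hφ⟩ := T.exists_aut_apply_eq' h𝒢 W₀ htransT (CovObj.basePt W₀) t₁
  refine ⟨φ, ?_⟩
  symm
  apply CovObj.descend_unique
  refine T.univCoverOver_hom_ext _ h𝒢 _ _ (CovObj.basePt W₀) ?_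
  change ((CovObj.projOver f W₀ h𝒢).fV _).hom.hom ((φ.hom.fV _).hom.hom (CovObj.basePt W₀)) =
    (ψ.hom.fV _).hom.hom (((CovObj.projOver f W₀ h𝒢).fV _).hom.hom (CovObj.basePt W₀))
  exact (congrArg (fun z => ((CovObj.projOver f W₀ h𝒢).fV _).hom.hom z) hφ).trans ht₁

end ProfiniteSemiGraph

end Literature.AnabelianGeometry.SemiGraphs
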